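import Mathlib
import HarnessLib

/-!
# Fourier uniqueness for the even part: if all Gaussian–cosine moments of a bounded continuous `g : ℝ² → ℝ` vanish, then `g(x) + g(−x) = 0`
# (def-free content of the registered stub `stub_sliceDensity` of LINE g19-A «transverse slice» on crux ⟨stmt-QuantumFields-23035⟩ `ShortRootRigidity`)

Route `F4SubCurvatureDoor` (rung R2d `BalabanLadder.ROT`), LINE g19-A of seat ym-idea-3 (tree skeleton
`Cruxes/ShortRootRigidity/Lines/transverse_slice.lean`, obligation (3) `SliceDensity`: rotation invariance of all Gaussian–cosine transverse
slices of a kernel forces even-part slice invariance).  This module proves the analytic heart, DEF-FREE and for a general bounded continuous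
`g` on a finite-dimensional real inner product space `V`:

★ `add_neg_eq_zero_of_integral_cosGauss_eq_zero`: if `∫ g(x)·cos⟪a,x⟫·e^{−‖x‖²/2} dx = 0` for every `a ∈ V`, then `g(x) + g(−x) = 0` for all `x`.

Proof: `h := (g + g∘(−))·e^{−‖·‖²/2}` is continuous and integrable; its Fourier transform vanishes (`𝓕h(w) = ∫cos(2π⟪v,w⟫)h − i∫sin(2π⟪v,w⟫)h`:
the cosine part is twice the hypothesis at `a = 2π•w` after `v ↦ −v`, the sine part vanishes because `h` is even), so Mathlib's Fourier
inversion `Continuous.fourierInv_fourier_eq` gives `h = 𝓕⁻0 = 0`.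

HONEST FRAMING: a folklore analysis lemma (Fourier uniqueness); the registered stub is derived from it in the sibling `…Registered` module;
the heart `stub_planarRigidity` (XL), the other stubs, crux 23035 / 23125, rung R2d and every summit statement are untouched; the Yang–Mills
mass gap is NOT proved (width seat ym-line-sfw-p2-w3 g35 of cell ym-idea-1, free hands).  Mathlib only; 0 `def`, 0 `sorry`.
-/

set_option autoImplicit false

noncomputable section

open MeasureTheory Complex Real
open scoped RealInnerProductSpace FourierTransform Topology

namespace Summit.QuantumFields.YangMills.Theorems.F4SubCurvatureDoorSliceFourier

variable {V : Type*} [NormedAddCommGroup V] [InnerProductSpace ℝ V] [FiniteDimensional ℝ V] [MeasurableSpace V] [BorelSpace V]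

/-- The real Gaussian `v ↦ e^{−‖v‖²/2}` is integrable on a finite-dimensional real inner product space. [folklore] -/
theorem integrable_exp_neg_half_sq_norm : Integrable (fun v : V => Real.exp (-(‖v‖ ^ 2 / 2))) := by
  have h := (GaussianFourier.integrable_cexp_neg_mul_sq_norm_add (V := V) (b := (1 / 2 : ℂ))
    (by norm_num) 0 0).norm
  refine h.congr (ae_of_all _ fun v => ?_)
  simp only [zero_mul, add_zero, Complex.norm_exp]
  congr 1
  have : (-(1 / 2 : ℂ) * (‖v‖ : ℂ) ^ 2).re = -(‖v‖ ^ 2 / 2) := by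
    rw [show (-(1 / 2 : ℂ) * (‖v‖ : ℂ) ^ 2) = ((-(‖v‖ ^ 2 / 2) : ℝ) : ℂ) by push_cast; ring]
    exact Complex.ofReal_re _
  exact this

/-- A bounded continuous function times the Gaussian is integrable. [folklore] -/
theorem integrable_mul_gauss {f : V → ℝ} (hf : Continuous f) {C : ℝ} (hC : ∀ x, |f x| ≤ C) :
    Integrable (fun v : V => f v * Real.exp (-(‖v‖ ^ 2 / 2))) := by
  refine Integrable.mono' (integrable_exp_neg_half_sq_norm.const_mul C)
    (hf.mul (by fun_prop)).aestronglyMeasurable (ae_of_all _ fun v => ?_)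
  rw [Real.norm_eq_abs, abs_mul, Real.abs_exp]
  exact mul_le_mul_of_nonneg_right (hC v) (Real.exp_pos _).le

/-- ★ **Fourier uniqueness for the even part.**  If `g : V → ℝ` is continuous and bounded and every Gaussian–cosine moment vanishes,
`∫ g(x)·cos⟪a,x⟫·e^{−‖x‖²/2} dx = 0` for all `a`, then `g(x) + g(−x) = 0` for every `x`. [folklore] -/
theorem add_neg_eq_zero_of_integral_cosGauss_eq_zero {g : V → ℝ} (hg : Continuous g) {C : ℝ} (hC : ∀ x, |g x| ≤ C)
    (h : ∀ a : V, ∫ x, g x * (Real.cos ⟪a, x⟫ * Real.exp (-(‖x‖ ^ 2 / 2))) = 0) (x : V) :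
    g x + g (-x) = 0 := by
  -- the even part times the Gaussian, real and complex
  set hr : V → ℝ := fun v => (g v + g (-v)) * Real.exp (-(‖v‖ ^ 2 / 2)) with hhr
  set hc : V → ℂ := fun v => ((hr v : ℝ) : ℂ) with hhc
  have hg' : Continuous fun v : V => g (-v) := hg.comp continuous_neg
  have hsum_cont : Continuous fun v : V => g v + g (-v) := hg.add hg'
  have hsum_bd : ∀ v, |g v + g (-v)| ≤ C + C := fun v => (abs_add_le _ _).trans (add_le_add (hC v) (hC (-v)))
  have hr_cont : Continuous hr := hsum_cont.mul (by fun_prop)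
  have hr_int : Integrable hr := integrable_mul_gauss hsum_cont hsum_bd
  have hc_cont : Continuous hc := Complex.continuous_ofReal.comp hr_cont
  have hc_int : Integrable hc := hr_int.ofReal
  -- even
  have hr_even : ∀ v, hr (-v) = hr v := fun v => by simp only [hhr, neg_neg, norm_neg]; ring
  -- the two real moments of `hr` against `cos(2π⟪v,w⟫)` and `sin(2π⟪v,w⟫)` vanish
  have hcos : ∀ w : V, ∫ v, Real.cos (2 * π * ⟪v, w⟫) * hr v = 0 := by
    intro w
    -- both halves equal the hypothesis at `a = (2π) • w`
    have hcw : Continuous fun v : V => Real.cos ⟪(2 * π) • w, v⟫ :=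
      Real.continuous_cos.comp (continuous_const.inner continuous_id)
    have hint1 : Integrable (fun v : V => g v * (Real.cos ⟪(2 * π) • w, v⟫ * Real.exp (-(‖v‖ ^ 2 / 2)))) := by
      have hf : Continuous fun v : V => g v * Real.cos ⟪(2 * π) • w, v⟫ := hg.mul hcw
      have := integrable_mul_gauss hf (C := C * 1) (fun v => by
        rw [abs_mul]; exact mul_le_mul (hC v) (Real.abs_cos_le_one _) (abs_nonneg _) ((abs_nonneg _).trans (hC v)))
      refine this.congr (ae_of_all _ fun v => ?_); ring
    have hint2 : Integrable (fun v : V => g (-v) * (Real.cos ⟪(2 * π) • w, v⟫ * Real.exp (-(‖v‖ ^ 2 / 2)))) := by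
      have hf : Continuous fun v : V => g (-v) * Real.cos ⟪(2 * π) • w, v⟫ := hg'.mul hcw
      have := integrable_mul_gauss hf (C := C * 1) (fun v => by
        rw [abs_mul]; exact mul_le_mul (hC (-v)) (Real.abs_cos_le_one _) (abs_nonneg _) ((abs_nonneg _).trans (hC v)))
      refine this.congr (ae_of_all _ fun v => ?_); ring
    have hinner : ∀ v : V, Real.cos (2 * π * ⟪v, w⟫) = Real.cos ⟪(2 * π) • w, v⟫ := fun v => by
      rw [real_inner_smul_left, real_inner_comm]
    have h1 : ∫ v, g v * (Real.cos ⟪(2 * π) • w, v⟫ * Real.exp (-(‖v‖ ^ 2 / 2))) = 0 := h ((2 * π) • w)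
    have h2 : ∫ v, g (-v) * (Real.cos ⟪(2 * π) • w, v⟫ * Real.exp (-(‖v‖ ^ 2 / 2))) = 0 := by
      have hsub := integral_neg_eq_self (fun v : V => g v * (Real.cos ⟪(2 * π) • w, v⟫ * Real.exp (-(‖v‖ ^ 2 / 2)))) volume
      simp only [inner_neg_right, Real.cos_neg, norm_neg] at hsub
      rw [hsub]; exact h1
    calc ∫ v, Real.cos (2 * π * ⟪v, w⟫) * hr v
        = ∫ v, (g v * (Real.cos ⟪(2 * π) • w, v⟫ * Real.exp (-(‖v‖ ^ 2 / 2))) +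
            g (-v) * (Real.cos ⟪(2 * π) • w, v⟫ * Real.exp (-(‖v‖ ^ 2 / 2)))) := by
          refine integral_congr_ae (ae_of_all _ fun v => ?_)
          simp only [hhr, hinner v]; ring
      _ = 0 := by rw [integral_add hint1 hint2, h1, h2, add_zero]
  have hsin : ∀ w : V, ∫ v, Real.sin (2 * π * ⟪v, w⟫) * hr v = 0 := by
    intro w
    -- the integrand is odd
    have hsub := integral_neg_eq_self (fun v : V => Real.sin (2 * π * ⟪v, w⟫) * hr v) volume
    simp only [inner_neg_left, mul_neg, Real.sin_neg, hr_even, neg_mul] at hsub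
    rw [integral_neg] at hsub
    linarith
  -- hence the Fourier transform of `hc` vanishes
  have hF : 𝓕 hc = 0 := by
    funext w
    rw [Real.fourier_eq' hc w, Pi.zero_apply]
    have hsplit : ∀ v : V, Complex.exp ((↑(-2 * π * ⟪v, w⟫) * Complex.I)) • hc v =
        (((Real.cos (2 * π * ⟪v, w⟫) * hr v : ℝ) : ℂ) - Complex.I * ((Real.sin (2 * π * ⟪v, w⟫) * hr v : ℝ) : ℂ)) := by
      intro v
      rw [smul_eq_mul, hhc]
      dsimp only
      rw [show ((-2 * π * ⟪v, w⟫ : ℝ) : ℂ) * Complex.I = ((-(2 * π * ⟪v, w⟫) : ℝ) : ℂ) * Complex.I by push_cast; ring,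
        Complex.exp_mul_I, ← Complex.ofReal_cos, ← Complex.ofReal_sin, Real.cos_neg, Real.sin_neg]
      push_cast
      ring
    have hphase : Continuous fun v : V => 2 * π * ⟪v, w⟫ := continuous_const.mul (continuous_id.inner continuous_const)
    have hint_c : Integrable (fun v : V => (((Real.cos (2 * π * ⟪v, w⟫) * hr v : ℝ) : ℂ))) := by
      refine (Integrable.ofReal ?_)
      exact hr_int.bdd_mul (c := 1) (Real.continuous_cos.comp hphase).aestronglyMeasurable
        (ae_of_all _ fun v => by rw [Real.norm_eq_abs]; exact Real.abs_cos_le_one _)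
    have hint_s : Integrable (fun v : V => (((Real.sin (2 * π * ⟪v, w⟫) * hr v : ℝ) : ℂ))) := by
      refine (Integrable.ofReal ?_)
      exact hr_int.bdd_mul (c := 1) (Real.continuous_sin.comp hphase).aestronglyMeasurable
        (ae_of_all _ fun v => by rw [Real.norm_eq_abs]; exact Real.abs_sin_le_one _)
    simp_rw [hsplit]
    rw [integral_sub hint_c (hint_s.const_mul _), integral_const_mul, integral_complex_ofReal, integral_complex_ofReal, hcos w, hsin w]
    simp
  -- Fourier inversion: `hc = 𝓕⁻ (𝓕 hc) = 𝓕⁻ 0 = 0`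
  have hinv := hc_cont.fourierInv_fourier_eq hc_int (by rw [hF]; exact integrable_zero _ _ _)
  have hzero : hc x = 0 := by
    rw [← hinv, hF]
    simp [Real.fourierInv_eq]
  -- read off
  have hrx : hr x = 0 := by
    have := hzero; simp only [hhc, Complex.ofReal_eq_zero] at this; exact this
  have hexp : Real.exp (-(‖x‖ ^ 2 / 2)) ≠ 0 := (Real.exp_pos _).ne'
  have := hrx
  simp only [hhr, mul_eq_zero, hexp, or_false] at this
  exact this

end Summit.QuantumFields.YangMills.Theorems.F4SubCurvatureDoorSliceFourier

end
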